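import Literature.Probability.RandomMatrix.TruncationHybridLaws
import HarnessLib

/-!
# The hybrid argument: from the Ginibre array to the Gram–Schmidt array in `n` steps

For `1 ≤ n`, `2n ≤ m` and `g` a family of `n` i.i.d. standard complex Gaussian vectors of `ℂ^m`,
the arrays `hybridMatrix k g` (`k = 0, …, n`; columns `< k` orthonormalised by Gram–Schmidt,
scaled by `√m` and truncated to the first `n` coordinates, columns `≥ k` raw) interpolate between
the Ginibre law (`k = 0`) and the law of the scaled truncated Gram–Schmidt array (`k = n`, the
truncated Haar law). The main result `tvClose_ginibre_map_hybridMatrix` is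

  `‖Law(hybridMatrix 0 g) − Law(hybridMatrix n g)‖_TV ≤ 10 n³/m`.

Each step `k → k+1` (`tvClose_hybridMatrix_succ`) replaces the raw column `k` by the
Gram–Schmidt column `k`: conditionally on the other columns `y` the two laws of column `k` are
`γ^n` and the law of `truncProjNormalize_{V(y)}` with `V(y)` the span of the first `k` columns
(`gramSchmidtNormed_eq_smul_starProjection`), which are `8n²/m + 2∑_{i<n}‖P_{V(y)}e_i‖²`-close
(`tvClose_truncProjNormalize`); the mixture bound (`tvClose_map_prod_mixture`) and the averaged
projection bound (`integral_sum_normSqProj_le`, `≤ nk/m`) give the step bound `8n²/m + 2nk/m ≤ 10n²/m`.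
-/

open MeasureTheory ProbabilityTheory WithLp Matrix InnerProductSpace Submodule Module
open scoped ENNReal NNReal

namespace Literature.Probability.RandomMatrix

open Literature.MeasureTheory.TotalVariation

variable {m : ℕ}

/-- Inserting at position `kk` does not affect the other positions. [folklore] -/
theorem insertNth_apply_of_ne {α : Type*} {n' : ℕ} (kk : Fin (n' + 1)) (x x' : α) (y : Fin n' → α)
    {j : Fin (n' + 1)} (h : j ≠ kk) :
    (Fin.insertNth kk x y : Fin (n' + 1) → α) j = (Fin.insertNth kk x' y : Fin (n' + 1) → α) j := by
  obtain ⟨j', rfl⟩ := Fin.exists_succAbove_eq h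
  rw [Fin.insertNth_apply_succAbove, Fin.insertNth_apply_succAbove]

/-- Congruence of orthogonal projections along an equality of subspaces. [folklore] -/
theorem starProjection_congr {V V' : Submodule ℂ (EuclideanSpace ℂ (Fin m))} (h : V = V')
    (z : EuclideanSpace ℂ (Fin m)) : V.starProjection z = V'.starProjection z := by
  subst h; rfl

section Step

variable {n' : ℕ}

/-- Columns `j ≠ kk` of `hybridMatrix k'` (`k' ≤ k+1`, `kk = k`) do not depend on column `kk` of
the input (the Gram–Schmidt columns `j < k` only use the columns `≤ j`). [folklore] -/
theorem hybridMatrix_insertNth_of_ne (hle : n' + 1 ≤ m) {k : ℕ} (hk : k < n' + 1) {k' : ℕ} (hk' : k' ≤ k + 1)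
    (x x' : EuclideanSpace ℂ (Fin m)) (y : Fin n' → EuclideanSpace ℂ (Fin m)) (i : Fin (n' + 1))
    {j : Fin (n' + 1)} (hj : j ≠ ⟨k, hk⟩) :
    hybridMatrix hle k' (Fin.insertNth ⟨k, hk⟩ x y : Fin (n' + 1) → EuclideanSpace ℂ (Fin m)) i j =
      hybridMatrix hle k' (Fin.insertNth ⟨k, hk⟩ x' y : Fin (n' + 1) → EuclideanSpace ℂ (Fin m)) i j := by
  unfold hybridMatrix gsTruncMatrix
  by_cases hjk : (j : ℕ) < k'
  · rw [if_pos hjk, if_pos hjk]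
    have hgs : gramSchmidtNormed ℂ (Fin.insertNth ⟨k, hk⟩ x y : Fin (n' + 1) → EuclideanSpace ℂ (Fin m)) j =
        gramSchmidtNormed ℂ (Fin.insertNth ⟨k, hk⟩ x' y : Fin (n' + 1) → EuclideanSpace ℂ (Fin m)) j := by
      refine gramSchmidtNormed_congr fun i' hi' => insertNth_apply_of_ne _ _ _ _ fun h => ?_
      subst h
      have h1 : k ≤ (j : ℕ) := hi'
      have h2 : (j : ℕ) = k := by omega
      exact hj (Fin.ext h2)
    rw [hgs]
  · rw [if_neg hjk, if_neg hjk, insertNth_apply_of_ne _ x x' y hj]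

/-- Columns `j ≠ k` of `hybridMatrix (k+1)` and `hybridMatrix k` agree. [folklore] -/
theorem hybridMatrix_succ_of_ne (hle : n' + 1 ≤ m) {k : ℕ} (hk : k < n' + 1)
    (g : Fin (n' + 1) → EuclideanSpace ℂ (Fin m)) (i : Fin (n' + 1)) {j : Fin (n' + 1)} (hj : j ≠ ⟨k, hk⟩) :
    hybridMatrix hle (k + 1) g i j = hybridMatrix hle k g i j := by
  unfold hybridMatrix
  have hjv : (j : ℕ) ≠ k := fun h => hj (Fin.ext h)
  by_cases hjk : (j : ℕ) < k
  · rw [if_pos hjk, if_pos (by omega)]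
  · rw [if_neg hjk, if_neg (by omega)]

/-- The image of the initial segment below `kk = k` under `insertNth kk x y` is the range of the
first `k` columns (which do not involve `x`). [folklore] -/
theorem image_insertNth_Iio (hle : n' + 1 ≤ m) {k : ℕ} (hk : k < n' + 1)
    (x : EuclideanSpace ℂ (Fin m)) (y : Fin n' → EuclideanSpace ℂ (Fin m)) :
    (Fin.insertNth ⟨k, hk⟩ x y : Fin (n' + 1) → EuclideanSpace ℂ (Fin m)) '' Set.Iio ⟨k, hk⟩ =
      Set.range fun l : Fin k =>
        (Fin.insertNth ⟨k, hk⟩ 0 y : Fin (n' + 1) → EuclideanSpace ℂ (Fin m)) (Fin.castLE hk.le l) := by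
  have _ := hle
  ext w
  simp only [Set.mem_image, Set.mem_Iio, Set.mem_range]
  constructor
  · rintro ⟨i, hi, rfl⟩
    have hi' : (i : ℕ) < k := hi
    refine ⟨⟨i, hi'⟩, ?_⟩
    have : Fin.castLE hk.le ⟨i, hi'⟩ = i := Fin.ext rfl
    rw [this]
    exact insertNth_apply_of_ne _ _ _ _ (fun h => by subst h; exact lt_irrefl _ hi')
  · rintro ⟨l, rfl⟩
    refine ⟨Fin.castLE hk.le l, ?_, ?_⟩
    · show ((Fin.castLE hk.le l : Fin (n' + 1)) : ℕ) < k
      simp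
    · exact insertNth_apply_of_ne _ _ _ _ (fun h => by
        have := congrArg Fin.val h; simp at this; omega)

/-- **One step of the hybrid argument**: replacing the raw column `k` by the Gram–Schmidt column
`k` costs at most `8n²/m + 2nk/m` in total variation. [folklore] -/
theorem tvClose_hybridMatrix_succ (hmn : 2 * (n' + 1) ≤ m) (hle : n' + 1 ≤ m) {k : ℕ} (hk : k < n' + 1) :
    TVClose ((ginibre m (n' + 1)).map (hybridMatrix hle k))
      ((ginibre m (n' + 1)).map (hybridMatrix hle (k + 1)))
      (8 * ((n' + 1 : ℕ) : ℝ) ^ 2 / m + 2 * (((n' + 1 : ℕ) : ℝ) * k / m)) := by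
  set kk : Fin (n' + 1) := ⟨k, hk⟩ with hkk
  set γE := gaussianEuc (Fin m) with hγE
  set Γ' := ginibre m n' with hΓ'
  -- the maps
  set ins : EuclideanSpace ℂ (Fin m) → (Fin n' → EuclideanSpace ℂ (Fin m)) → (Fin (n' + 1) → EuclideanSpace ℂ (Fin m)) :=
    fun x y => Fin.insertNth kk x y with hins
  set cols : (Fin n' → EuclideanSpace ℂ (Fin m)) → Fin k → EuclideanSpace ℂ (Fin m) :=
    fun y l => ins 0 y (Fin.castLE hk.le l) with hcols
  set F₀ : (Fin n' → EuclideanSpace ℂ (Fin m)) → EuclideanSpace ℂ (Fin m) → (Fin (n' + 1) → ℂ) :=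
    fun _ x i => x (Fin.castLE hle i) with hF₀
  set F₁ : (Fin n' → EuclideanSpace ℂ (Fin m)) → EuclideanSpace ℂ (Fin m) → (Fin (n' + 1) → ℂ) :=
    fun y x i => hybridMatrix hle (k + 1) (ins x y) i kk with hF₁
  set C : (Fin n' → EuclideanSpace ℂ (Fin m)) → Fin (n' + 1) → Fin (n' + 1) → ℂ :=
    fun y => hybridMatrix hle k (ins 0 y) with hC
  set Asm : (Fin n' → EuclideanSpace ℂ (Fin m)) × (Fin (n' + 1) → ℂ) → Fin (n' + 1) → Fin (n' + 1) → ℂ :=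
    fun q i j => if j = kk then q.2 i else C q.1 i j with hAsm
  -- measurability
  have hins_m : Measurable (Function.uncurry fun (y : Fin n' → EuclideanSpace ℂ (Fin m)) (x : EuclideanSpace ℂ (Fin m)) => ins x y) := by
    have : (Function.uncurry fun (y : Fin n' → EuclideanSpace ℂ (Fin m)) (x : EuclideanSpace ℂ (Fin m)) => ins x y) =
        (MeasurableEquiv.piFinSuccAbove (fun _ : Fin (n' + 1) => EuclideanSpace ℂ (Fin m)) kk).symm ∘ Prod.swap := by
      funext q; rfl
    rw [this]
    exact (MeasurableEquiv.measurable _).comp measurable_swap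
  have hF₀m : Measurable (Function.uncurry F₀) :=
    measurable_pi_lambda _ fun i => (measurable_pi_apply (Fin.castLE hle i)).comp
      ((measurable_ofLp_two (Fin m)).comp measurable_snd)
  have hF₁m : Measurable (Function.uncurry F₁) := by
    have : Function.uncurry F₁ = (fun g i => hybridMatrix hle (k + 1) g i kk) ∘
        Function.uncurry fun (y : Fin n' → EuclideanSpace ℂ (Fin m)) (x : EuclideanSpace ℂ (Fin m)) => ins x y := by
      funext q; rfl
    rw [this]
    refine Measurable.comp ?_ hins_m
    exact measurable_pi_lambda _ fun i => (measurable_pi_apply kk).comp ((measurable_pi_apply i).comp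
      (measurable_hybridMatrix hle (k + 1)))
  have hC_m : Measurable C :=
    (measurable_hybridMatrix hle k).comp (hins_m.comp (measurable_id.prodMk measurable_const))
  have hcols_m : Measurable cols :=
    measurable_pi_lambda _ fun l => (measurable_pi_apply _).comp
      (hins_m.comp (measurable_id.prodMk measurable_const))
  have hAsm_m : Measurable Asm := by
    refine measurable_pi_lambda _ fun i => measurable_pi_lambda _ fun j => ?_
    by_cases hj : j = kk
    · simp only [hAsm, hj, if_true]
      exact (measurable_pi_apply i).comp measurable_snd
    · simp only [hAsm, hj, if_false]
      exact (measurable_pi_apply j).comp ((measurable_pi_apply i).comp (hC_m.comp measurable_fst))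
  -- (I1), (I2): the two hybrid arrays as assembled columns
  have hI1 : ∀ x y, hybridMatrix hle k (ins x y) = Asm (y, F₀ y x) := by
    intro x y; funext i; funext j
    by_cases hj : j = kk
    · subst hj
      simp only [hAsm, if_true, hF₀]
      unfold hybridMatrix
      rw [if_neg (lt_irrefl k)]
      simp only [hins, Fin.insertNth_apply_same]
    · simp only [hAsm, hj, if_false, hC]
      exact hybridMatrix_insertNth_of_ne hle hk (Nat.le_succ k) x 0 y i hj
  have hI2 : ∀ x y, hybridMatrix hle (k + 1) (ins x y) = Asm (y, F₁ y x) := by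
    intro x y; funext i; funext j
    by_cases hj : j = kk
    · subst hj
      simp only [hAsm, if_true, hF₁]
    · simp only [hAsm, hj, if_false, hC]
      rw [hybridMatrix_insertNth_of_ne hle hk le_rfl x 0 y i hj, hybridMatrix_succ_of_ne hle hk _ i hj]
  -- (I3): the new column is `truncProjNormalize` for the span of the first `k` columns
  set Vsp : (Fin n' → EuclideanSpace ℂ (Fin m)) → Submodule ℂ (EuclideanSpace ℂ (Fin m)) :=
    fun y => span ℂ (Set.range (cols y)) with hVsp
  have hI3 : ∀ y x, F₁ y x = truncProjNormalize hle (Vsp y) x := by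
    intro y x; funext i
    simp only [hF₁]
    unfold hybridMatrix gsTruncMatrix truncProjNormalize
    rw [if_pos (Nat.lt_succ_self k), gramSchmidtNormed_eq_smul_starProjection]
    have hspan : span ℂ ((ins x y) '' Set.Iio kk) = Vsp y := by
      simp only [hVsp, hcols, hins, hkk]
      rw [image_insertNth_Iio hle hk x y]
    have hx : ins x y kk = x := by simp only [hins, Fin.insertNth_apply_same]
    rw [hx, starProjection_congr (congrArg Submodule.orthogonal hspan) x]
    rw [WithLp.ofLp_smul, Pi.smul_apply, smul_eq_mul]
    norm_cast
  -- the fibrewise bound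
  have hV : ∀ y, finrank ℂ (Vsp y) + 1 ≤ n' + 1 := by
    intro y
    have h1 := finrank_range_le_card (R := ℂ) (cols y)
    rw [Fintype.card_fin] at h1
    have h2 : finrank ℂ (Vsp y) ≤ k := h1
    omega
  set ε : (Fin n' → EuclideanSpace ℂ (Fin m)) → ℝ := fun y =>
    8 * ((n' + 1 : ℕ) : ℝ) ^ 2 / m + 2 * ∑ i : Fin (n' + 1), normSqProj (Fin.castLE hle i) (cols y) with hε
  have hstep : ∀ y, TVClose (γE.map (F₀ y)) (γE.map (F₁ y)) (ε y) := by
    intro y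
    have h0 : γE.map (F₀ y) = gaussianPi (Fin (n' + 1)) := gaussianEuc_map_castLE hle
    have h1 : F₁ y = truncProjNormalize hle (Vsp y) := funext (hI3 y)
    rw [h0, h1]
    exact tvClose_truncProjNormalize (Nat.succ_pos n') hmn hle (Vsp y) (hV y)
  have hεm : Measurable ε := by
    refine measurable_const.add (measurable_const.mul (Finset.measurable_sum _ fun i _ => ?_))
    exact (measurable_normSqProj _).comp hcols_m
  have hεint : Integrable ε Γ' := by
    refine Integrable.of_bound hεm.aestronglyMeasurable
      (8 * ((n' + 1 : ℕ) : ℝ) ^ 2 / m + 2 * (n' + 1 : ℕ)) (Filter.Eventually.of_forall fun y => ?_)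
    have hs : ∑ i : Fin (n' + 1), normSqProj (Fin.castLE hle i) (cols y) ≤ (n' + 1 : ℕ) := by
      calc ∑ i : Fin (n' + 1), normSqProj (Fin.castLE hle i) (cols y) ≤ ∑ _i : Fin (n' + 1), (1:ℝ) :=
            Finset.sum_le_sum fun i _ => normSqProj_le_one _ _
        _ = (n' + 1 : ℕ) := by simp
    have hs0 : 0 ≤ ∑ i : Fin (n' + 1), normSqProj (Fin.castLE hle i) (cols y) :=
      Finset.sum_nonneg fun i _ => normSqProj_nonneg _ _
    have h8 : 0 ≤ 8 * ((n' + 1 : ℕ) : ℝ) ^ 2 / m := by positivity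
    rw [Real.norm_eq_abs, abs_of_nonneg (by positivity)]
    simp only [hε]
    linarith
  -- the mixture bound, pushed forward by the assembly map
  have hmix := (tvClose_map_prod_mixture Γ' γE hF₀m hF₁m hεint hstep).map hAsm_m
  have hΦ₀ : Measurable (fun p : (Fin n' → EuclideanSpace ℂ (Fin m)) × EuclideanSpace ℂ (Fin m) =>
      (p.1, F₀ p.1 p.2)) := measurable_fst.prodMk hF₀m
  have hΦ₁ : Measurable (fun p : (Fin n' → EuclideanSpace ℂ (Fin m)) × EuclideanSpace ℂ (Fin m) =>
      (p.1, F₁ p.1 p.2)) := measurable_fst.prodMk hF₁m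
  rw [Measure.map_map hAsm_m hΦ₀, Measure.map_map hAsm_m hΦ₁] at hmix
  -- identify the two sides with the laws of the hybrid arrays
  set e := MeasurableEquiv.piFinSuccAbove (fun _ : Fin (n' + 1) => EuclideanSpace ℂ (Fin m)) kk with he
  have hmp := measurePreserving_piFinSuccAbove (fun _ : Fin (n' + 1) => gaussianEuc (Fin m)) kk
  have hcol : ginibre m (n' + 1) = ((Γ'.prod γE).map Prod.swap).map e.symm := by
    rw [Measure.prod_swap, ginibre, ← hmp.symm.map_eq]
    rfl
  have hlaw : ∀ (k' : ℕ) (G : (Fin n' → EuclideanSpace ℂ (Fin m)) → EuclideanSpace ℂ (Fin m) → (Fin (n' + 1) → ℂ)),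
      Measurable (Function.uncurry G) → (∀ x y, hybridMatrix hle k' (ins x y) = Asm (y, G y x)) →
      (ginibre m (n' + 1)).map (hybridMatrix hle k') =
        (Γ'.prod γE).map (Asm ∘ fun q => (q.1, G q.1 q.2)) := by
    intro k' G hG hid
    rw [hcol, Measure.map_map (measurable_hybridMatrix hle k') e.symm.measurable,
      Measure.map_map ((measurable_hybridMatrix hle k').comp e.symm.measurable) measurable_swap]
    congr 1
    funext q
    rcases q with ⟨y, x⟩
    simp only [Function.comp_apply, Prod.swap_prod_mk, he, MeasurableEquiv.piFinSuccAbove_symm_apply]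
    exact hid x y
  rw [← hlaw k F₀ hF₀m hI1, ← hlaw (k + 1) F₁ hF₁m hI2] at hmix
  refine hmix.mono ?_
  -- the averaged bound
  have hequiv : ∀ (σ : Equiv.Perm (Fin m)) (y : Fin n' → EuclideanSpace ℂ (Fin m)),
      cols (fun j => LinearIsometryEquiv.piLpCongrLeft 2 ℂ ℂ σ (y j)) =
        fun l => LinearIsometryEquiv.piLpCongrLeft 2 ℂ ℂ σ (cols y l) := by
    intro σ y; funext l
    simp only [hcols, hins]
    have hne : (Fin.castLE hk.le l : Fin (n' + 1)) ≠ kk := fun h => by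
      have := congrArg Fin.val h
      simp [hkk] at this
      exact (Nat.ne_of_lt l.2) this
    obtain ⟨j', hj'⟩ := Fin.exists_succAbove_eq hne
    rw [← hj', Fin.insertNth_apply_succAbove, Fin.insertNth_apply_succAbove]
  have havg := integral_sum_normSqProj_le (n' := n') (k := k) hle cols hcols_m hequiv
  have hint_sum : Integrable (fun y => ∑ i : Fin (n' + 1), normSqProj (Fin.castLE hle i) (cols y)) Γ' := by
    refine Integrable.of_bound ((Finset.measurable_sum _ fun i _ =>
      (measurable_normSqProj _).comp hcols_m).aestronglyMeasurable) ((n' + 1 : ℕ)) (Filter.Eventually.of_forall fun y => ?_)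
    rw [Real.norm_eq_abs, abs_of_nonneg (Finset.sum_nonneg fun i _ => normSqProj_nonneg _ _)]
    calc ∑ i : Fin (n' + 1), normSqProj (Fin.castLE hle i) (cols y) ≤ ∑ _i : Fin (n' + 1), (1:ℝ) :=
          Finset.sum_le_sum fun i _ => normSqProj_le_one _ _
      _ = (n' + 1 : ℕ) := by simp
  simp only [hε]
  rw [integral_add (integrable_const _) (hint_sum.const_mul 2), integral_const, integral_const_mul]
  simp only [probReal_univ, one_smul]
  linarith

end Step

/-! ### The chain -/

/-- **The hybrid chain**: `‖Law(hybridMatrix 0) − Law(hybridMatrix k)‖_TV ≤ 10 n² k/m` for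
`k ≤ n` (`n = n' + 1`, `2n ≤ m`). [folklore] -/
theorem tvClose_hybridMatrix_zero_le {n' : ℕ} (hmn : 2 * (n' + 1) ≤ m) (hle : n' + 1 ≤ m) :
    ∀ k : ℕ, k ≤ n' + 1 →
      TVClose ((ginibre m (n' + 1)).map (hybridMatrix hle 0))
        ((ginibre m (n' + 1)).map (hybridMatrix hle k))
        (10 * ((n' + 1 : ℕ) : ℝ) ^ 2 * k / m) := by
  intro k
  induction k with
  | zero =>
    intro _
    simpa using TVClose.refl ((ginibre m (n' + 1)).map (hybridMatrix hle 0))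
  | succ k ih =>
    intro hk
    have hk' : k < n' + 1 := hk
    have h1 := ih hk'.le
    have h2 := tvClose_hybridMatrix_succ hmn hle hk'
    refine (h1.triangle h2).mono ?_
    have hm : (0:ℝ) < m := by
      have : 0 < m := by omega
      exact_mod_cast this
    have hkR : (k:ℝ) ≤ (n' + 1 : ℕ) := by exact_mod_cast hk'.le
    have hnpos : (0:ℝ) ≤ ((n' + 1 : ℕ) : ℝ) := by positivity
    set N : ℝ := ((n' + 1 : ℕ) : ℝ) with hN
    rw [Nat.cast_succ]
    have e1 : 10 * N ^ 2 * k / m + (8 * N ^ 2 / m + 2 * (N * k / m)) =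
        (10 * N ^ 2 * k + 8 * N ^ 2 + 2 * N * k) / m := by ring
    have e2 : 10 * N ^ 2 * ((k:ℝ) + 1) / m = (10 * N ^ 2 * k + 10 * N ^ 2) / m := by ring
    rw [e1, e2]
    refine div_le_div_of_nonneg_right ?_ hm.le
    nlinarith [mul_le_mul_of_nonneg_left hkR hnpos]

/-- **Total variation between the Ginibre array and the Gram–Schmidt array**:
`‖Law(hybridMatrix 0 g) − Law(gsTruncMatrix g)‖_TV ≤ 10 n³/m` for `1 ≤ n`, `2n ≤ m`. [folklore] -/
theorem tvClose_ginibre_map_hybridMatrix {n : ℕ} (hn : 1 ≤ n) (hmn : 2 * n ≤ m) (hle : n ≤ m) :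
    TVClose ((ginibre m n).map (hybridMatrix hle 0)) ((ginibre m n).map (gsTruncMatrix hle))
      (10 * (n:ℝ) ^ 3 / m) := by
  obtain ⟨n', rfl⟩ : ∃ n', n = n' + 1 := ⟨n - 1, by omega⟩
  have h := tvClose_hybridMatrix_zero_le hmn hle (n' + 1) le_rfl
  rw [hybridMatrix_self] at h
  refine h.mono (le_of_eq ?_)
  ring

end Literature.Probability.RandomMatrix
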